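import Summits.AtomisticToContinuum.Crystallization.Theorems.TornFree.Negative.TolFamily

/-!
# Crux `TornFree` (stmt-AtomisticToContinuum-18069) — strategist census, `## Strengthen` entry:
# the GAP BOOTSTRAP strengthening is tight at `1.327`

Candidate strengthening examined by the strategist seat (STRATEGY-CENSUS.md, `## Strengthen`):

> `GapBootstrap θ` : every all-gapped-twelve configuration at `(τ, γ) = (1/50, 63/50)` (the
> hypothesis of `TornFree`, at every site) has NO pair of sites at distance in `[63a/50, θ·a)` —
> i.e. the gap `(1.02a, 1.26a)` self-improves to `(1.02a, θa)`.

Were it true for some `θ` above the snub-disphenoid diagonal (`≈ 1.2892 × bond ≤ 1.315a`), the far-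
triad / S8 tears would die two-centre (lead c1, kit j025640: the S8 two-centre cluster is feasible at
gap ratio `1.30`, slack `+0.0010`, infeasible at `1.32`, slack `−0.0009`) and `TornFree` would become
`TornFreeTol (1/50) θ`-local with two centres.

THIS FILE (kernel-checked, `decide` on an integer certificate replayed by
`TolFamily.cert_model`): a tetragonally strained fcc lattice — in-plane bonds at the TOP of the
window (`1.01995a`), out-of-plane bonds at the BOTTOM (`0.98005a`) — is all-gapped-twelve at
`(1/50, 63/50)`, its sample bond has exactly FOUR common neighbours (untorn, fcc topology), and it has
a pair of sites at distance EXACTLY `1.3272a` (the `c`-translate).  Analytically the infimum over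
tetragonal strains is `2·√(0.98² − 1.02²/2) = 1.32695…`, which is also the minimum diagonal of ANY
octahedral hole with its twelve edges in `[0.98, 1.02]` (equator = bonded 4-cycle of circumradius
`≤ 1.02/√2`).  Hence `GapBootstrap θ` is FALSE for every `θ > 1.32695`, while the torn S8 cluster
needs `θ ≳ 1.31` to die (two-centre) — the usable window `θ ∈ (≈1.31, 1.3269]` leaves the killing
certificate a slack of at most `≈ 1.6e-3` (interpolating j025640), an order of magnitude THINNER than
the live line's class margins (`4.5e-3 … 2.2e-2`).  Recorded as "no leverage" in the census.

Search data, not literature facts; nothing here is a route item.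
-/

noncomputable section

namespace Summit.AtomisticToContinuum.Crystallization.Cruxes.TornFree.StrategyCensus

open Summit.AtomisticToContinuum.Crystallization.Theorems.TornFree.Negative
open Literature.Geometry.DiscreteGeometry

/-- Box of the tetragonal-fcc certificate: conventional cell `14424 × 14424 × 13272` in units
`a/10000` (search data, not a literature fact). -/
def tfccL : Fin 3 → ℤ := ![14424, 14424, 13272]

/-- Motif of the tetragonal-fcc certificate: the four points of the conventional face-centred cell
(search data, not a literature fact). -/
def tfccP : Fin 4 → Fin 3 → ℤ :=
  ![![0, 0, 0], ![7212, 7212, 0], ![7212, 0, 6636], ![0, 7212, 6636]]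

set_option maxRecDepth 8000 in
/-- The tetragonal fcc configuration is a periodic certificate at
`(lo2, hi2, gam2) = (9800², 10200², 12600²)`: scale `D = 10000`, `τ = 1/50`, `γ = 63/50` — every
site of the infinite periodic set is gapped-twelve. [folklore] -/
theorem tfcc_cert : Cert 4 tfccL tfccP 96040000 104040000 158760000 :=
  ⟨by decide, by decide, by decide, by decide, by decide, by decide, by decide⟩

/-- The sample bond `P 0 — P 1` (in-plane) has exactly four common bonded neighbours. -/
theorem tfcc_commonIdx_card : (commonIdx tfccL tfccP 104040000 0 1 13).card = 4 := by decide

/-- `P 0 — P 1` is a bond. -/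
theorem tfcc_bond : sqd tfccL tfccP 0 1 (off27 13) ≤ 104040000 := by decide

/-- The `c`-translate of `P 0` (offset `off27 14 = (0,0,1)`) is at squared distance `13272²`. -/
theorem tfcc_ctranslate_sqd : sqd tfccL tfccP 0 0 (off27 14) = 13272 ^ 2 := by decide

/-- **Tightness of the gap bootstrap at `1.3272`.**  There is an infinite configuration, all of
whose sites are gapped-twelve at `(a, 1/50, 63/50)` (the hypothesis of `TornFree` everywhere), with
an untorn sample bond (exactly four commons) and two sites at distance exactly `a · 1.3272` — inside
`[1.26a, 1.33a)`.  So "all-gapped-twelve at `(1/50, 63/50)` ⇒ no pair in `[1.26a, θa)`" fails for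
every `θ > 1.3272` (analytically: for every `θ > 2√(0.98² − 0.5202) = 1.32695…`). [folklore] -/
theorem gapBootstrap_tight :
    ∃ (Y : Set (EuclideanSpace ℝ (Fin 3))) (a : ℝ), 0 < a ∧ Y.Infinite ∧
      (∀ y ∈ Y, GappedTwelveAt (1 / 50) (63 / 50) Y a y) ∧
      (∃ y ∈ Y, ∃ v ∈ Y, v ≠ y ∧ dist y v ≤ a * (1 + 1 / 50) ∧
        (commons (1 / 50) Y a y v).ncard = 4) ∧
      ∃ p ∈ Y, ∃ q ∈ Y, dist p q = a * (3318 / 2500) := by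
  obtain ⟨hinf, hall, hb⟩ := cert_model tfcc_cert (1 / 50) (63 / 50) 10000 (by norm_num)
    (by norm_num) (by norm_num) (by norm_num) (by norm_num) (by norm_num) (by norm_num)
  obtain ⟨hy, hv, hvy, hdist, hcount⟩ := hb 0 1 13 (by decide)
  refine ⟨perSet tfccL tfccP, (10000 : ℕ), by norm_num, hinf (by norm_num), hall,
    ⟨_, hy, _, hv, hvy, hdist.2 tfcc_bond, by rw [hcount, tfcc_commonIdx_card]⟩,
    pp tfccL tfccP (0, 0), Set.mem_range_self _, pp tfccL tfccP (0, off27 14),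
    Set.mem_range_self _, ?_⟩
  have hle : dist (pp tfccL tfccP (0, 0)) (pp tfccL tfccP (0, off27 14)) ≤ 13272 := by
    rw [dist_pp_le_iff tfccL tfccP (c2 := 13272 ^ 2) (by norm_num) (by norm_num), sub_zero,
      tfcc_ctranslate_sqd]
  have hge : (13272 : ℝ) ≤ dist (pp tfccL tfccP (0, 0)) (pp tfccL tfccP (0, off27 14)) := by
    rw [le_dist_pp_iff tfccL tfccP (c2 := 13272 ^ 2) (by norm_num) (by norm_num), sub_zero,
      tfcc_ctranslate_sqd]
  push_cast
  linarith

end Summit.AtomisticToContinuum.Crystallization.Cruxes.TornFree.StrategyCensus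

end
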